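import Literature.NumberTheory.Transcendental.ExpOneTranscendenceMeasureProofs
import Summits.Schanuel.Schanuel.Theorems.RootDecomp1KLogLogCell08
import Summits.Schanuel.Schanuel.Theorems.RootDecomp1KTwoBaseCell09
import Summits.Schanuel.Schanuel.Theorems.RootDecomp1KGapCell10
import Summits.Schanuel.Schanuel.Theorems.RootDecomp1KCommonRadixCell06
import Summits.Schanuel.Schanuel.Theorems.RootDecomp1KMeasuredWallCell07
import Summits.Schanuel.Schanuel.Theorems.RootDecomp1KOnePointCell09
import Summits.Schanuel.Schanuel.Theorems.RootDecomp1KRelLiouvilleCell08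

/-!
# RootDecomp1KNWMeasureHolds — lens 1, generation 44 ADDENDUM D: the route's binder `hNW : NWMeasure` (= Literature NW96 Theorem 4 (2), the transcendence measure of e — NOT NW96 Theorem 1) DISCHARGED BY NAME (`nwMeasure_holds := NesterenkoWaldschmidt1996_thm_4_2_holds`) now that the farm builds `ExpOneTranscendenceMeasureProofs`; the e-wall cells of record (LogLog / TwoBase / Gap / CommonRadix / MeasuredWall / OnePoint / RelLiouville) and the member decisions of item 33364 re-issued HYPOTHESIS-FREE, one primed one-liner each — part 1 (RootDecomp1KNWMeasureHolds): the discharge + hypothesis-free re-issues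

(lens-1 g44 HOME file addD/NWMeasureHolds.lean 3316090c…, 198 l, imports Literature ExpOneTranscendenceMeasureProofs + tree LogLogCell08 / TwoBaseCell09 / GapCell10 / CommonRadixCell06 / MeasuredWallCell07 / OnePointCell09 / RelLiouvilleCell08; NODE L2132, critic VERDICT L2140 (D as RootDecomp1KNWMeasureHolds, GO LOW — a CITATION of the Literature theorem, no credit; booked cells stay booked as they were); port by census-1 gen 18 as ONE file. PORT EDITS: the axiom-guard section and `set_option linter.dupNamespace false` dropped; eight one-line docstrings added; statements and proofs verbatim. `--supports stmt-Schanuel-33364`; no census credit carried; rung 0 — nothing here proves Schanuel.)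
-/

/-!
# RootDecomp1KNWMeasureHolds — addendum D of NODE g44 (lens 1): the route's binder `hNW : NWMeasure`
# DISCHARGED BY NAME for the e-wall cells OF RECORD (tree imports only; 0 sorry; axioms standard)

`Summit.Schanuel.Schanuel.Theorems.RootDecomp1KHyper.NWMeasure` (Hyper01 l.105) is, LITERALLY (`Iff.rfl`), the
Literature fact `Literature.NumberTheory.Transcendental.NesterenkoWaldschmidt1996_thm_4_2` (NW96 Theorem 4 (2):
the transcendence MEASURE OF `e`, `|P(e)| ≥ exp(−1.3·10⁵ d² (log L + d))`), and that fact is PROVED in the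
Literature library: `NesterenkoWaldschmidt1996_thm_4_2_holds` (`ExpOneTranscendenceMeasureProofs.lean` l.459,
sorry-free).  When the cells below were ported the check farm did not build that module's cone (Hyper01 l.102,
RelLiouvilleCell01 l.70–71, RelLiouvilleCell08 l.27, MeasuredWallCell05 l.33: «discharge by name when that cone is
built»); it builds now (NODE g44, 2026-08-31).  This file is the by-name discharge for the tree's e-wall cells and
member decisions OF RECORD — one primed one-liner each, statement = the tree statement with the binder
`(hNW : NWMeasure)` removed, proof = the tree theorem applied to `nwMeasure_holds`.  It is a CITATION of the
Literature theorem (no new mathematics, no credit claimed; booked cells stay booked as they were); its only point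
is that from here on `SB` at `z_E, z_W, z_G′, z_G, z_V, z_M, z_P, z_R` and the class-level e-walls are available
HYPOTHESIS-FREE by name.

NOT NW96 Theorem 1: the binder `hNW : Literature…NesterenkoWaldschmidt1996_thm_1` of Generic13/16/19/20,
FiniteOrderCell, KummerClosure, DarkLogSq, 1E TwoScale (constant `211`, printed-proof gap certified in
`RootDecomp1KNW96Gap`) is a DIFFERENT proposition and is NOT discharged here or anywhere.
CONSTANT-DEPENDENCE: none of the statements below mentions `1.3·10⁵`; `NWMeasure` enters every cell through
`polyMeasure_exp_one_of_NW : NWMeasure → PolyMeasure (cexp 1)` (an `∃ C` statement).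
-/

open Summit.Schanuel.Schanuel.Theorems
open Summit.Schanuel.Schanuel.Theorems.RootDecomp1KHyper
open Summit.Schanuel.Schanuel.Theorems.RootDecomp1KHyper.HyperCell
open LiouvilleNumber

namespace Summit.Schanuel.Schanuel.Theorems.RootDecomp1KNWMeasureHolds

/-! ## §1  The discharge -/

/-- **`NWMeasure` HOLDS** — it is the Literature theorem NW96 Thm 4 (2). -/
theorem nwMeasure_holds : NWMeasure :=
  Literature.NumberTheory.Transcendental.NesterenkoWaldschmidt1996_thm_4_2_holds

/-- READ-BACK: `NWMeasure` IS, literally, `NesterenkoWaldschmidt1996_thm_4_2`. -/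
theorem nwMeasure_iff_literature :
    NWMeasure ↔ Literature.NumberTheory.Transcendental.NesterenkoWaldschmidt1996_thm_4_2 :=
  Iff.rfl

/-- `e` has a polynomial transcendence measure — HYPOTHESIS-FREE (e-twin of the tree's `polyMeasure_pi`). -/
theorem polyMeasure_exp_one_holds : PolyMeasure (Complex.exp 1) :=
  polyMeasure_exp_one_of_NW nwMeasure_holds

/-! ## §2  The class-level e-wall cells of record, HYPOTHESIS-FREE -/

/-- LogLogCell08 `sb_logLogCell`: `(1, ℓ₂, ρ)`, `ρ` log-log-Liouville. -/
theorem sb_logLogCell' {ρ : ℝ} (hρ : RootDecomp1KLogLogCell.LogLogLiouville ρ) :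
    SB 3 ![(1 : ℂ), ((liouvilleNumber 2 : ℝ) : ℂ), (ρ : ℂ)] :=
  RootDecomp1KLogLogCell.sb_logLogCell nwMeasure_holds hρ

/-- OnePointCell07 `sb_onePointCell`: `(1, ℓ₂, ℓ₃, ρ)`, `ρ` log-log-Liouville. -/
theorem sb_onePointCell' {ρ : ℝ} (hρ : RootDecomp1KLogLogCell.LogLogLiouville ρ) :
    SB 4 ![(1 : ℂ), ((liouvilleNumber 2 : ℝ) : ℂ), ((liouvilleNumber 3 : ℝ) : ℂ), (ρ : ℂ)] :=
  RootDecomp1KOnePointCell.sb_onePointCell nwMeasure_holds hρ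

/-- RelLiouvilleCell08 `sb_relLiouvilleCell`: `(1, ℓ₂, ρ)`, `ρ` log-hyper-Liouville. -/
theorem sb_relLiouvilleCell' {ρ : ℝ} (hρ : RootDecomp1KRelLiouvilleCell.LogHyperLiouville ρ) :
    SB 3 ![(1 : ℂ), ((liouvilleNumber 2 : ℝ) : ℂ), (ρ : ℂ)] :=
  RootDecomp1KRelLiouvilleCell.sb_relLiouvilleCell nwMeasure_holds hρ

/-- MeasuredWallCell05 `sb_measuredWallCell`: `(1, ℓ₂, ℓ₃, ρ)`, `ρ` log-hyper-Liouville. -/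
theorem sb_measuredWallCell' {ρ : ℝ} (hρ : RootDecomp1KRelLiouvilleCell.LogHyperLiouville ρ) :
    SB 4 ![(1 : ℂ), ((liouvilleNumber 2 : ℝ) : ℂ), ((liouvilleNumber 3 : ℝ) : ℂ), (ρ : ℂ)] :=
  RootDecomp1KMeasuredWallCell.sb_measuredWallCell nwMeasure_holds hρ

/-- GapCell04 `sb_gapWall3`: `(1, ℓ_b, ρ)`, `b ≥ 2`, `ρ` factorial-gap-Liouville. -/
theorem sb_gapWall3' {b : ℕ} (hb : 2 ≤ b) {ρ : ℝ} (hρ : RootDecomp1KGapCell.FactorialGapLiouville ρ) :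
    SB 3 ![(1 : ℂ), ((liouvilleNumber b : ℝ) : ℂ), (ρ : ℂ)] :=
  RootDecomp1KGapCell.sb_gapWall3 nwMeasure_holds hb hρ

/-- GapCell04 `sb_gapWall4`: `(1, ℓ₂, ℓ₃, ρ)`, `ρ` factorial-gap-Liouville. -/
theorem sb_gapWall4' {ρ : ℝ} (hρ : RootDecomp1KGapCell.FactorialGapLiouville ρ) :
    SB 4 ![(1 : ℂ), ((liouvilleNumber 2 : ℝ) : ℂ), ((liouvilleNumber 3 : ℝ) : ℂ), (ρ : ℂ)] :=
  RootDecomp1KGapCell.sb_gapWall4 nwMeasure_holds hρ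

/-- TwoBaseCell05 `sb_twoBaseCell`: `(1, ℓ₂, ℓ₃)`. -/
theorem sb_twoBaseCell' :
    SB 3 ![(1 : ℂ), ((liouvilleNumber 2 : ℝ) : ℂ), ((liouvilleNumber 3 : ℝ) : ℂ)] :=
  RootDecomp1KTwoBaseCell.sb_twoBaseCell nwMeasure_holds

/-- TwoBaseCell05 `sb_multiBaseCell`: `(1, ℓ_{b₁}, …, ℓ_{b_k})`, multiplicatively independent bases. -/
theorem sb_multiBaseCell' {k : ℕ} {b : Fin k → ℕ} (hb : ∀ i, 2 ≤ b i)
    (hinj : Function.Injective fun m : Fin k →₀ ℕ => ∏ i, b i ^ m i) :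
    SB (k + 1) (Fin.cons (1 : ℂ) (fun i => ((liouvilleNumber (b i) : ℝ) : ℂ))) :=
  RootDecomp1KTwoBaseCell.sb_multiBaseCell nwMeasure_holds hb hinj

/-- CommonRadixCell04 `sb_liouvilleBlockCell`: `(1, ℓ_{b⃗})` for an algebraically independent Liouville block. -/
theorem sb_liouvilleBlockCell' {k : ℕ} {b : Fin k → ℕ} (hb : ∀ i, 2 ≤ b i)
    (hAI : AlgebraicIndependent ℚ (fun i => ((liouvilleNumber (b i) : ℝ) : ℂ))) :
    SB (k + 1) (Fin.cons (1 : ℂ) (fun i => ((liouvilleNumber (b i) : ℝ) : ℂ))) :=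
  RootDecomp1KCommonRadixCell.sb_liouvilleBlockCell nwMeasure_holds hb hAI

/-- CommonRadixCell04 `sb_commonRadixCell`: `(1, ℓ_{β^{a₁}}, …, ℓ_{β^{a_k}})`, distinct exponents. -/
theorem sb_commonRadixCell' {k : ℕ} {β : ℕ} (hβ : 2 ≤ β) {a : Fin k → ℕ}
    (ha : Function.Injective a) (ha1 : ∀ i, 1 ≤ a i) :
    SB (k + 1) (Fin.cons (1 : ℂ) (fun i => ((liouvilleNumber ((β ^ a i : ℕ) : ℝ) : ℝ) : ℂ))) :=
  RootDecomp1KCommonRadixCell.sb_commonRadixCell nwMeasure_holds hβ ha ha1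

/-- CommonRadixCell04 `sb_wallCell24`: `(1, ℓ₂, ℓ₄)`. -/
theorem sb_wallCell24' :
    SB 3 ![(1 : ℂ), ((liouvilleNumber 2 : ℝ) : ℂ), ((liouvilleNumber 4 : ℝ) : ℂ)] :=
  RootDecomp1KCommonRadixCell.sb_wallCell24 nwMeasure_holds

/-! ## §3  The member e-walls of record and the decisions of item 33364 there, HYPOTHESIS-FREE -/

/-- `SB 3 z_E` hypothesis-free (the tree cell applied to `nwMeasure_holds`). -/
theorem sb_zE' : SB 3 RootDecomp1KLogLogCell.zE := RootDecomp1KLogLogCell.sb_zE nwMeasure_holds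
/-- `SB 3 z_W` hypothesis-free. -/
theorem sb_zW' : SB 3 RootDecomp1KTwoBaseCell.zW := RootDecomp1KTwoBaseCell.sb_zW nwMeasure_holds
/-- `SB 3 z_G` hypothesis-free. -/
theorem sb_zG3' : SB 3 RootDecomp1KGapCell.zG3 := RootDecomp1KGapCell.sb_zG3 nwMeasure_holds
/-- `SB 4 z_G⁴` hypothesis-free. -/
theorem sb_zG4' : SB 4 RootDecomp1KGapCell.zG4 := RootDecomp1KGapCell.sb_zG4 nwMeasure_holds
/-- `SB 3 z_V` hypothesis-free. -/
theorem sb_zV' : SB 3 RootDecomp1KCommonRadixCell.zV := RootDecomp1KCommonRadixCell.sb_zV nwMeasure_holds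
/-- `SB 4 z_M` hypothesis-free. -/
theorem sb_zM' : SB 4 RootDecomp1KMeasuredWallCell.zM := RootDecomp1KMeasuredWallCell.sb_zM nwMeasure_holds
/-- `SB 4 z_P` hypothesis-free. -/
theorem sb_zP' : SB 4 RootDecomp1KOnePointCell.zP := RootDecomp1KOnePointCell.sb_zP nwMeasure_holds
/-- `SB 3 z_R` hypothesis-free. -/
theorem sb_zR' : SB 3 RootDecomp1KRelLiouvilleCell.zR := RootDecomp1KRelLiouvilleCell.sb_zR nwMeasure_holds

/-- LogLogCell08: item 33364 DECIDED at `z_E = (1, ℓ₂, ρ_E)` — scope (i)–(iii) AND `SB 3`, HYPOTHESIS-FREE. -/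
theorem finiteOrderLiouvilleSchanuel_at_zE' :
    LinearIndependent ℚ RootDecomp1KLogLogCell.zE ∧ LinLiouville RootDecomp1KLogLogCell.zE ∧
      ¬ HyperLinLiouville RootDecomp1KLogLogCell.zE ∧ SB 3 RootDecomp1KLogLogCell.zE :=
  RootDecomp1KLogLogCell.finiteOrderLiouvilleSchanuel_at_zE nwMeasure_holds

/-- TwoBaseCell09: item 33364 DECIDED at `z_W = (1, ℓ₂, ℓ₃)`, HYPOTHESIS-FREE. -/
theorem finiteOrderLiouvilleSchanuel_at_zW' :
    LinearIndependent ℚ RootDecomp1KTwoBaseCell.zW ∧ LinLiouville RootDecomp1KTwoBaseCell.zW ∧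
      ¬ HyperLinLiouville RootDecomp1KTwoBaseCell.zW ∧ SB 3 RootDecomp1KTwoBaseCell.zW :=
  RootDecomp1KTwoBaseCell.finiteOrderLiouvilleSchanuel_at_zW nwMeasure_holds

/-- GapCell08: item 33364 DECIDED at `z_G′ = (1, ℓ₂, ρ_W)`, HYPOTHESIS-FREE. -/
theorem finiteOrderLiouvilleSchanuel_at_zG3' :
    LinearIndependent ℚ RootDecomp1KGapCell.zG3 ∧ LinLiouville RootDecomp1KGapCell.zG3 ∧
      ¬ HyperLinLiouville RootDecomp1KGapCell.zG3 ∧ SB 3 RootDecomp1KGapCell.zG3 :=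
  RootDecomp1KGapCell.finiteOrderLiouvilleSchanuel_at_zG3 nwMeasure_holds

/-- GapCell10: item 33364 DECIDED at `z_G = (1, ℓ₂, ℓ₃, ρ_W)`, HYPOTHESIS-FREE. -/
theorem finiteOrderLiouvilleSchanuel_at_zG4' :
    LinearIndependent ℚ RootDecomp1KGapCell.zG4 ∧ LinLiouville RootDecomp1KGapCell.zG4 ∧
      ¬ HyperLinLiouville RootDecomp1KGapCell.zG4 ∧ SB 4 RootDecomp1KGapCell.zG4 :=
  RootDecomp1KGapCell.finiteOrderLiouvilleSchanuel_at_zG4 nwMeasure_holds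

/-- CommonRadixCell06: item 33364 DECIDED at `z_V = (1, ℓ₂, ℓ₄)`, HYPOTHESIS-FREE. -/
theorem finiteOrderLiouvilleSchanuel_at_zV' :
    LinearIndependent ℚ RootDecomp1KCommonRadixCell.zV ∧ LinLiouville RootDecomp1KCommonRadixCell.zV ∧
      ¬ HyperLinLiouville RootDecomp1KCommonRadixCell.zV ∧ SB 3 RootDecomp1KCommonRadixCell.zV :=
  RootDecomp1KCommonRadixCell.finiteOrderLiouvilleSchanuel_at_zV nwMeasure_holds

/-- MeasuredWallCell07: item 33364 DECIDED at `z_M = (1, ℓ₂, ℓ₃, ℓ_T)`, HYPOTHESIS-FREE. -/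
theorem finiteOrderLiouvilleSchanuel_at_zM' :
    LinearIndependent ℚ RootDecomp1KMeasuredWallCell.zM ∧ LinLiouville RootDecomp1KMeasuredWallCell.zM ∧
      ¬ HyperLinLiouville RootDecomp1KMeasuredWallCell.zM ∧ SB 4 RootDecomp1KMeasuredWallCell.zM :=
  RootDecomp1KMeasuredWallCell.finiteOrderLiouvilleSchanuel_at_zM nwMeasure_holds

/-- OnePointCell09: item 33364 DECIDED at `z_P = (1, ℓ₂, ℓ₃, ρ_E)`, HYPOTHESIS-FREE. -/
theorem finiteOrderLiouvilleSchanuel_at_zP' :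
    LinearIndependent ℚ RootDecomp1KOnePointCell.zP ∧ LinLiouville RootDecomp1KOnePointCell.zP ∧
      ¬ HyperLinLiouville RootDecomp1KOnePointCell.zP ∧ SB 4 RootDecomp1KOnePointCell.zP :=
  RootDecomp1KOnePointCell.finiteOrderLiouvilleSchanuel_at_zP nwMeasure_holds

/-- RelLiouvilleCell08: item 33364 DECIDED at `z_R = (1, ℓ₂, ℓ_T)`, HYPOTHESIS-FREE. -/
theorem finiteOrderLiouvilleSchanuel_at_zR' :
    LinearIndependent ℚ RootDecomp1KRelLiouvilleCell.zR ∧ LinLiouville RootDecomp1KRelLiouvilleCell.zR ∧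
      ¬ HyperLinLiouville RootDecomp1KRelLiouvilleCell.zR ∧ SB 3 RootDecomp1KRelLiouvilleCell.zR :=
  RootDecomp1KRelLiouvilleCell.finiteOrderLiouvilleSchanuel_at_zR nwMeasure_holds

/-- **ALL EIGHT member decisions of record for item 33364 on the e-walls, HYPOTHESIS-FREE, in one conjunction.** -/
theorem memberDecisions_hypothesisFree :
    SB 3 RootDecomp1KLogLogCell.zE ∧ SB 3 RootDecomp1KTwoBaseCell.zW ∧ SB 3 RootDecomp1KGapCell.zG3 ∧
    SB 4 RootDecomp1KGapCell.zG4 ∧ SB 3 RootDecomp1KCommonRadixCell.zV ∧ SB 4 RootDecomp1KMeasuredWallCell.zM ∧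
    SB 4 RootDecomp1KOnePointCell.zP ∧ SB 3 RootDecomp1KRelLiouvilleCell.zR :=
  ⟨sb_zE', sb_zW', sb_zG3', sb_zG4', sb_zV', sb_zM', sb_zP', sb_zR'⟩

end Summit.Schanuel.Schanuel.Theorems.RootDecomp1KNWMeasureHolds
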